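import Mathlib
import HarnessLib
import Summits.NavierStokesRegularity.Statement
import Summits.NavierStokesRegularity.NavierStokesRegularity.Theses.ConservativeEngine
import Summits.NavierStokesRegularity.NavierStokesRegularity.Theorems.EulerZoomLiouvillePowerGaugeEulerLiouvilleWindowFluxBoundsSplit
import Summits.NavierStokesRegularity.NavierStokesRegularity.Theorems.EulerZoomLiouvillePowerGaugeEulerLiouvilleExtinctIdentity

/-!
# BC5 WITNESS OF WEAKNESS for N30's deciding crux X_Eᶜ = `ConservativeEngine.ConservativePowerGaugeEulerLiouville`
# (stmt-NavierStokesRegularity-27529) — decomp-ns lens 6, generation 23, 2026-08-30.  Landable as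
# `Theorems/ConservativeEngineExtinctRung.lean --supports stmt-NavierStokesRegularity-27529` (writer's call).  0 sorry.

The tribunal kernel of route `ConservativeEngine` (born 17:32Z) reports `t3:absent` — no first rung was named at birth.
The rung EXISTS in the tree: `Theorems.PowerGaugeEulerLiouville.ExtinctTrace.extinctIdentity` (ns-ezl-w1 g4, p649850):
for `2/9 < ρ ≤ 1/2` a member of Seregin's power-gauged ancient Euler class `K_ρ` that (i) satisfies the LOCAL ENERGY
EQUALITY and (ii) is energy-EXTINCT at the collapse instant (`∫_{B_a}|u(τ)|² → 0`, `τ → 0⁻`, every `a`) vanishes a.e.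
This file states that theorem in the crux's OWN binder shape (the verbatim hypotheses of 27529, plus the window and the
extinction hypothesis) and proves it from the landed decls — so the witness is syntactically «X_Eᶜ restricted to a stratum»:

* `ExtinctRung`                                            — the rung statement (Prop);
* `conservativePowerGaugeEulerLiouville_extinctRung`       — the rung HOLDS (0 sorry; `extinctIdentity` + the landed
                                                              final-window flux bound `exists_oneBall_window_le_split`);
* `extinctRung_of_conservativePowerGaugeEulerLiouville`    — the rung is a RESTRICTION of the crux (crux ⇒ rung, logic).

WHY IT IS A WITNESS (T3): the rung USES the route's lever (hypothesis (i), the conservativity that N30 added to X_E 19832: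
the proof runs the local energy equality against a cut-off of a large ball over the final window and lets the window flux
`≤ M a^{1/2−9ρ/4} → 0`, which is where `2/9` comes from), it decides a stratum of the crux's class that is NOT inside any
regime where Clay (A) is known (its NS-side image through N30's PROVED conservative zoom `ConservativeZoomReduction` is
«a ρ-power-zoomable first blow-up cannot drain its critical-rate local energy before the collapse in its own clock», which is
not a theorem in print), and it is STRICTLY WEAKER than the crux (the persistent stratum and the window `0 < ρ ≤ 2/9`
remain open: crux line `Lines/terminal_trace.lean`, stubs X3s/X3r/X4).  No summit, crux or stub is proved here.
-/

noncomputable section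

set_option linter.dupNamespace false
set_option linter.unusedVariables false

namespace Summit.NavierStokesRegularity.NavierStokesRegularity.Theorems.ConservativeEngine.ExtinctRung

open scoped Topology ENNReal NNReal RealInnerProductSpace
open Filter Set MeasureTheory Metric Function
open Literature.Analysis Literature.Analysis.FluidPDE

/-- **The rung statement**: N30's crux `ConservativePowerGaugeEulerLiouville` (stmt-27529) with its hypotheses VERBATIM,
restricted to the window `2/9 < ρ ≤ 1/2` and to energy-EXTINCT members. -/
def ExtinctRung : Prop :=
  ∀ ρ : ℝ, 2 / 9 < ρ → ρ ≤ 1 / 2 →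
    ∀ (u : ℝ → EuclideanSpace ℝ (Fin 3) → EuclideanSpace ℝ (Fin 3)) (p : ℝ → EuclideanSpace ℝ (Fin 3) → ℝ)
      (H : ℝ → EuclideanSpace ℝ (Fin 3) → EuclideanSpace ℝ (Fin 3) →L[ℝ] EuclideanSpace ℝ (Fin 3)) (c : NNReal),
      IsSuitableWeakSolutionOn (slab (EuclideanSpace ℝ (Fin 3)) (Set.Iio 0) isOpen_Iio) 0 0 u p →
      HasWeakSpatialGradientOn (slab (EuclideanSpace ℝ (Fin 3)) (Set.Iio 0) isOpen_Iio) u H →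
      (∀ a : ℝ, 0 < a →
        ENNReal.ofReal (a ^ (2 * ρ)) * cknA a (0 : ℝ × EuclideanSpace ℝ (Fin 3)) u +
            ENNReal.ofReal (a ^ ρ) * cknE a (0 : ℝ × EuclideanSpace ℝ (Fin 3)) H +
          ENNReal.ofReal (a ^ (2 * ρ)) * cknD a (0 : ℝ × EuclideanSpace ℝ (Fin 3)) p ≤ (c : ℝ≥0∞)) →
      (∀ φ : ℝ → EuclideanSpace ℝ (Fin 3) → ℝ,
        IsSpaceTimeTestOn (slab (EuclideanSpace ℝ (Fin 3)) (Set.Iio 0) isOpen_Iio) φ →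
        ∫ t, ∫ x, (‖u t x‖ ^ 2 * timeDeriv φ t x + (‖u t x‖ ^ 2 + 2 * p t x) * inner ℝ (u t x) (gradient (φ t) x)) = 0) →
      (∀ a : ℝ, 0 < a →
        Tendsto (fun τ : ℝ => ∫⁻ x in Metric.ball (0 : EuclideanSpace ℝ (Fin 3)) a, ‖u τ x‖ₑ ^ 2)
          (𝓝[<] (0 : ℝ)) (𝓝 0)) →
      Function.uncurry u =ᵐ[volume.restrict (Set.Iio (0 : ℝ) ×ˢ (Set.univ : Set (EuclideanSpace ℝ (Fin 3))))] 0

/-- **BC5 rung — HOLDS (0 sorry).**  `ExtinctTrace.extinctIdentity` (p649850) fed with the landed final-window flux bound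
`exists_oneBall_window_le_split` (β = 0). -/
theorem conservativePowerGaugeEulerLiouville_extinctRung : ExtinctRung := by
  intro ρ h1 h2 u p H c hsw hH hc hcons hext
  have hρ0 : 0 ≤ ρ := by linarith
  exact Summit.NavierStokesRegularity.NavierStokesRegularity.Theorems.PowerGaugeEulerLiouville.ExtinctTrace.extinctIdentity
    ρ h1 h2 u p H c ⟨hsw, hH, hc⟩
    (fun s hs =>
      Summit.NavierStokesRegularity.NavierStokesRegularity.Theorems.PowerGaugeEulerLiouville.exists_oneBall_window_le_split
        hρ0 hsw hH hc hs le_rfl)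
    ⟨hcons, hext⟩

/-- The rung is a RESTRICTION of N30's crux (crux ⇒ rung; pure logic — so the rung is a special case OF the crux). -/
theorem extinctRung_of_conservativePowerGaugeEulerLiouville
    (h : Summit.NavierStokesRegularity.NavierStokesRegularity.Theses.ConservativeEngine.ConservativePowerGaugeEulerLiouville) :
    ExtinctRung :=
  fun ρ h1 _h2 u p H c hsw hH hc hcons _hext => h ρ (by linarith) u p H c hsw hH hc hcons

/-- The window of the rung is DERIVED, not chosen (4c (iv)): the shell-flux exponent `3/2 − 9ρ/4 − 1` is negative iff
`2/9 < ρ`. -/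
theorem rungWindow_iff (ρ : ℝ) : 3 / 2 - 9 * ρ / 4 - 1 < 0 ↔ 2 / 9 < ρ := by
  constructor <;> intro h <;> linarith

end Summit.NavierStokesRegularity.NavierStokesRegularity.Theorems.ConservativeEngine.ExtinctRung
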